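import HarnessLib.Audit.LibrarySuggestionsDenyListCorCM
import Summits.HodgeConjecture.HodgeConjecture.Theorems.F0D6CmCurveBodyA
import Literature.NumberTheory.Automorphic.Liu2021.AppendixC.RecordCurveSec42Datum   -- ★ p772845: the «honest §4.2 datum» block (31 decls, FQNs `Literature.NumberTheory.Automorphic.Liu2021.AppendixC.restrictLevel` … `rhoEt_etaleHeckeDatumGSM`) of `Lines/D6CmCurveBody.lean` :40–:352 was ALREADY re-homed there (gate `dedup.fqn-exists` ×31 on the dropped part «Honest», LA7-p02 (g3) 2026-09-02T09:07:42Z) — imported BY NAME, not re-filed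
import HarnessLib

/-!
# `F0D6CmCurveBodyK2Leg` — ★ RE-HOME (rung-0 re-homing task; LEAD F0P6-plan (g4) «M-72») of `Lines/D6CmCurveBody.lean` (tree sha16 dc3f934b25190911, 1646 l., code-`sorry`-free), PART 1 of 5 (size-lint split; cut at top-level declaration boundaries: `F0D6CmCurveBodyK2Leg` → `…OpK2` → `…S2Probe` → `…StubShapes` → `F0D6CmCurveBody`).

The workfile's FIRST block (its lines :40–:352, the «honest §4.2 datum of the record curve»: `restrictLevel` … `rhoEt_etaleHeckeDatumGSM`, 31 declarations under
`namespace Literature.NumberTheory.Automorphic.Liu2021.AppendixC`) is NOT re-filed: those fully-qualified names ARE ALREADY ★ `Literature/NumberTheory/Automorphic/Liu2021/AppendixC/RecordCurveSec42Datum.lean`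
(p772845, an earlier Literature port of the same block) and are imported above BY NAME (gate `dedup.fqn-exists`). Everything from the workfile's line :353 on is re-homed in these five parts with the
NAMESPACES KEPT (`Literature.NumberTheory.Automorphic.Liu2021.AppendixC`, then `Summit.HodgeConjecture.CorCM.Lines.A3Liu418[.…]`), so every remaining FQN is unchanged; the `Lines` import `D6CmCurveBodyA` is switched to its ★ twin `Theorems.F0D6CmCurveBodyA` (p850704).

Why a re-home: a `Theorems/` file cannot import a `Lines/` workfile (F0P6-ref1 o-6), and closing stmt-HodgeConjecture-24832 at rung 0 needs the sorry-free Lines chain behind the gate (RE-HOME TABLE v1.3.1, LA7-plan (g4)); after the last part is ★ the workfile becomes a one-import SHIM (NO-CROSS-IMPORT rule, «M-72» (3)). Namespaces KEPT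
(re-opened below exactly as they stand at the cut, with their `open` lines); code bytes = the workfile՚s, docstrings included; options preamble = the workfile's.
HC_CM is proved only modulo the 7 printed citations (2 remaining: hLiu418 = stmt-HodgeConjecture-24832, h413 = stmt-HodgeConjecture-24833) until rung 0 closes; a re-home is count-neutral. -/

noncomputable section

open scoped TensorProduct NumberField
open NumberField IsDedekindDomain Filter
open Literature.NumberTheory.GaloisRepresentations
open Literature.NumberTheory.Automorphic
open Literature.NumberTheory.Automorphic.Liu2021.AppendixC
open scoped TensorProduct Matrix NumberField Kronecker ComplexOrder
open NumberField NumberField.InfinitePlace IsDedekindDomain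
open Summit.HodgeConjecture.CorCM.Model Summit.HodgeConjecture.CorCM.Model.HComp Summit.HodgeConjecture.CorCM.HComp
open Literature.AlgebraicGeometry.Motives (CMType)
open Literature.AlgebraicGeometry.ShimuraVarieties.UnitaryCanonicalModel
open Literature.NumberTheory.Automorphic Literature.NumberTheory.Automorphic.UnitaryGroup
open Literature.NumberTheory.Automorphic.IdeleClassGroup Literature.NumberTheory.Automorphic.Liu2021 Literature.NumberTheory.Automorphic.Liu2021.AppendixC
open Literature.NumberTheory.GaloisRepresentations Literature.RepresentationTheory.Liu2021 Literature.RepresentationTheory.HarrisKudlaSweet1996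
open Literature.AlgebraicGeometry.Liu2021 (IsAdmissibleElement)
open Literature.NumberTheory.Weil1964 Literature.NumberTheory.GelbartRogawski1991 Literature.NumberTheory.GelbartRogawski1991.UnitaryDualPair Literature.NumberTheory.GelbartRogawski1991.UnitaryDualPair.WeilCoinv
open Literature.NumberTheory.GelbartRogawski1991.UnitaryDualPair.LocalSplitting
open Literature.NumberTheory.Automorphic.Liu2021.Def411WeilCarriersDoubling
open Literature.NumberTheory.Automorphic.Liu2021.Def411WeilCarriers (TW JW JW_eq isSymm_TW isUnit_det_TW Rep Eps epsOf Chi rhoVAtLine)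


/-! ## Part K — THE K2 LEG (director s201 (3)(ii); A-p13 (g18) K2 bid 00:18:13Z; my shape 00:19:35Z): `S3ShapeM` DERIVED from
[D.9 on M⋆] VERBATIM + the K2 transport `(ψ, K2b, K2c)`, generic junction `s3M_clause_of_d9M_of_K2`; packaged shape `K2D9MShape`
(`∃ C_M X_M ψ, K2b ∧ K2c ∧ ∀ K, D9M K` — splits into the FACT [D.9 on M⋆] + `stub_K2` the minute A-p13's `C_M` has a name). -/

namespace Summit.HodgeConjecture.CorCM.Lines.A3Liu418


/-- `(1 ⊗ ψ⁻¹) ∘ (1 ⊗ ψ) = id` (plumbing). [folklore] -/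
private theorem baseChange_symm_apply_baseChange {R A M N : Type*} [CommRing R] [CommRing A] [Algebra R A]
    [AddCommGroup M] [Module R M] [AddCommGroup N] [Module R N] (ψ : M ≃ₗ[R] N) (z : A ⊗[R] M) :
    (ψ.symm.toLinearMap.baseChange A) ((ψ.toLinearMap.baseChange A) z) = z := by
  induction z using TensorProduct.induction_on with
  | zero => simp
  | tmul a m => simp [LinearMap.baseChange_tmul]
  | add x y hx hy => rw [map_add, map_add, hx, hy]

/-- `1 ⊗ ψ` intertwines `1 ⊗ T` with `1 ⊗ T′` when `ψ` intertwines `T` with `T′` (plumbing). [folklore] -/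
private theorem baseChange_intertwine {R A M N : Type*} [CommRing R] [CommRing A] [Algebra R A]
    [AddCommGroup M] [Module R M] [AddCommGroup N] [Module R N] (ψ : M →ₗ[R] N) (T : M →ₗ[R] M) (T' : N →ₗ[R] N)
    (h : ∀ y, ψ (T y) = T' (ψ y)) (z : A ⊗[R] M) :
    (ψ.baseChange A) ((T.baseChange A) z) = (T'.baseChange A) ((ψ.baseChange A) z) := by
  have hT : ψ.comp T = T'.comp ψ := LinearMap.ext h
  have key : (ψ.baseChange A).comp (T.baseChange A) = (T'.baseChange A).comp (ψ.baseChange A) := by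
    rw [← LinearMap.baseChange_comp, ← LinearMap.baseChange_comp, hT]
  exact LinearMap.congr_fun key z

/-- **THE K2 JUNCTION, generic**: the `S3ShapeM` clause at level `K` for the twisted GS tower `C_X` from [D.9 on M⋆] at level `K`
for ANY `C_M` over the same `P5` and a K2 transport `(ψ, hψH, hψF)`.  [cite: Liu2021, App. D Cor. D.9 (l. 5579–5584); Thm. D.6 (1) proof] -/
theorem s3M_clause_of_d9M_of_K2 (F : CMField) [IsGalois ℚ F] {ι₁ : F →+* ℂ} (ℓ : ℕ) [Fact ℓ.Prime]
    (ι' : ℂ ≃+* AlgebraicClosure ℚ_[ℓ]) (Jstar : Matrix (Fin 2) (Fin 2) (F : Type))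
    (K₀ : C5.OpenCompactSubgroup ↥(finAdelic ↥(maximalRealSubfield (F : Type)) (F : Type) (IsCMField.complexConj (F : Type)) 2 Jstar))
    (S : RecordSystemGS (F : Type) Jstar ι₁ K₀) (hU7ₛ : S.HeckeTranslateDefinedOver) (hLQ : S.IsLevelQuotient)
    (h4 : 4 ≤ Module.finrank ℚ (F : Type)) (isoₛ : ℕ → Prop)
    (hJ : (Jstar.map (IsCMField.complexConj (F : Type)))ᵀ = Jstar) (hJu : IsUnit Jstar)
    {W : Type} [AddCommGroup W] [Module ℂ W]
    (ω : Representation ℂ ↥(finAdelic ↥(maximalRealSubfield (F : Type)) (F : Type) (IsCMField.complexConj (F : Type)) 2 Jstar) W)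
    -- the untwisted datum (abstract here; A-p13 (g18)'s `C_M`) and the K2 transport
    (C_M : Sec42Data (Literature.NumberTheory.Automorphic.Liu2021.AppendixC.honestP5GSM (F : Type) Jstar K₀ S.M) isoₛ) (X_M : C_M.EtaleHeckeDatum ℓ)
    (ψ : (sec42DataGS S h4 isoₛ).etaleH1Tower ℓ ≃ₗ[ℚ_[ℓ]] C_M.etaleH1Tower ℓ)
    (hψH : ∀ (g : ↥(finAdelic ↥(maximalRealSubfield (F : Type)) (F : Type) (IsCMField.complexConj (F : Type)) 2 Jstar))
      (y : (sec42DataGS S h4 isoₛ).etaleH1Tower ℓ), ψ ((etaleHeckeDatumGS S hU7ₛ hLQ h4 isoₛ ℓ).rhoEt g y) = X_M.rhoEt g (ψ y))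
    (hψF : ∀ w : HeightOneSpectrum (𝓞 (F : Type)), (IsCMField.complexConj (F : Type)) • w ≠ w →
      ∀ 𝔓 ∈ w.primesAbove, ∀ σ : Field.absoluteGaloisGroup (F : Type), IsArithFrobAt (𝓞 (F : Type)) σ 𝔓 →
        ∃ σ' : Field.absoluteGaloisGroup (F : Type),
          (∃ 𝔓' ∈ (((IsCMField.complexConj (F : Type)) • w)).primesAbove, IsArithFrobAt (𝓞 (F : Type)) σ' 𝔓') ∧
          ∀ y, ψ ((sec42DataGS S h4 isoₛ).towerRep ℓ σ y) = C_M.towerRep ℓ σ' (ψ y))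
    (K : C5.SmallLevel K₀)
    -- [D.9 on M⋆] at level `K`, VERBATIM shape (same place `w′`, standard anchor)
    (hD9M : ∃ S₀ : Set (HeightOneSpectrum (𝓞 (F : Type))), S₀.Finite ∧
      ∀ w : HeightOneSpectrum (𝓞 (F : Type)), w ∉ S₀ → ∀ hw : (IsCMField.complexConj (F : Type)) • w ≠ w,
        (UnitaryGroup.isUnit_placeForm Jstar hJu w).unit ∈ glInt 2 (w.adicCompletion (F : Type)) →
            UnitaryGroup.IsHyperspecialAt ↥(maximalRealSubfield (F : Type)) (F : Type) (IsCMField.complexConj (F : Type)) 2 Jstar K.1.1 (w.under (𝓞 ↥(maximalRealSubfield (F : Type)))) →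
            ∀ 𝔓 ∈ w.primesAbove, ∀ σ : Field.absoluteGaloisGroup (F : Type), IsArithFrobAt (𝓞 (F : Type)) σ 𝔓 →
            ∀ g ∈ X_M.omegaHom ι' ω, ∀ x ∈ Representation.fixedPoints ω K.1.1,
              (Ideal.absNorm w.asIdeal : AlgebraicClosure ℚ_[ℓ]) •
                  (C_M.towerRep ℓ σ).baseChange (AlgebraicClosure ℚ_[ℓ])
                    ((C_M.towerRep ℓ σ).baseChange (AlgebraicClosure ℚ_[ℓ])
                      (g (UnitaryGroup.heckeTAt ↥(maximalRealSubfield (F : Type)) (F : Type) (IsCMField.complexConj (F : Type)) 2 Jstar ω K.1.1 (⟨w, rfl⟩ : UnitaryGroup.PlacesOver (F : Type) (w.under (𝓞 ↥(maximalRealSubfield (F : Type)))))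
                  (IsCMField.complexConj_ne_one (F : Type)) hJ hw (UnitaryGroup.isUnit_placeForm Jstar hJu w) (HeckeCharacter.uniformizer (F : Type) w) 2 x))) -
                (C_M.towerRep ℓ σ).baseChange (AlgebraicClosure ℚ_[ℓ])
                  (g (UnitaryGroup.heckeTAt ↥(maximalRealSubfield (F : Type)) (F : Type) (IsCMField.complexConj (F : Type)) 2 Jstar ω K.1.1 (⟨w, rfl⟩ : UnitaryGroup.PlacesOver (F : Type) (w.under (𝓞 ↥(maximalRealSubfield (F : Type)))))
                  (IsCMField.complexConj_ne_one (F : Type)) hJ hw (UnitaryGroup.isUnit_placeForm Jstar hJu w) (HeckeCharacter.uniformizer (F : Type) w) 1 x)) +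
                g x = 0) :
    -- CONCLUSION = `S3ShapeM`'s clause at level `K` (v14 text, token for token inside the binder prefix)
    ∃ S₀ : Set (HeightOneSpectrum (𝓞 (F : Type))), S₀.Finite ∧
      ∀ w : HeightOneSpectrum (𝓞 (F : Type)), w ∉ S₀ → ∀ hw : (IsCMField.complexConj (F : Type)) • w ≠ w,
        ∀ hw' : (IsCMField.complexConj (F : Type)) • ((IsCMField.complexConj (F : Type)) • w) ≠ ((IsCMField.complexConj (F : Type)) • w),
        (UnitaryGroup.isUnit_placeForm Jstar hJu ((IsCMField.complexConj (F : Type)) • w)).unit ∈ glInt 2 (((IsCMField.complexConj (F : Type)) • w).adicCompletion (F : Type)) →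
            UnitaryGroup.IsHyperspecialAt ↥(maximalRealSubfield (F : Type)) (F : Type) (IsCMField.complexConj (F : Type)) 2 Jstar K.1.1 (((IsCMField.complexConj (F : Type)) • w).under (𝓞 ↥(maximalRealSubfield (F : Type)))) →
            ∀ 𝔓 ∈ w.primesAbove, ∀ σ : Field.absoluteGaloisGroup (F : Type), IsArithFrobAt (𝓞 (F : Type)) σ 𝔓 →
            ∀ f' ∈ (etaleHeckeDatumGS S hU7ₛ hLQ h4 isoₛ ℓ).omegaHom ι' ω, ∀ x ∈ Representation.fixedPoints ω K.1.1,
              (Ideal.absNorm w.asIdeal : AlgebraicClosure ℚ_[ℓ]) •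
                  ((sec42DataGS S h4 isoₛ).towerRep ℓ σ).baseChange (AlgebraicClosure ℚ_[ℓ])
                    (((sec42DataGS S h4 isoₛ).towerRep ℓ σ).baseChange (AlgebraicClosure ℚ_[ℓ])
                      (f' (UnitaryGroup.heckeTAt ↥(maximalRealSubfield (F : Type)) (F : Type) (IsCMField.complexConj (F : Type)) 2 Jstar ω K.1.1 (⟨((IsCMField.complexConj (F : Type)) • w), rfl⟩ : UnitaryGroup.PlacesOver (F : Type) (((IsCMField.complexConj (F : Type)) • w).under (𝓞 ↥(maximalRealSubfield (F : Type)))))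
                  (IsCMField.complexConj_ne_one (F : Type)) hJ hw' (UnitaryGroup.isUnit_placeForm Jstar hJu ((IsCMField.complexConj (F : Type)) • w)) (HeckeCharacter.uniformizer (F : Type) ((IsCMField.complexConj (F : Type)) • w)) 2 x))) -
                ((sec42DataGS S h4 isoₛ).towerRep ℓ σ).baseChange (AlgebraicClosure ℚ_[ℓ])
                  (f' (UnitaryGroup.heckeTAt ↥(maximalRealSubfield (F : Type)) (F : Type) (IsCMField.complexConj (F : Type)) 2 Jstar ω K.1.1 (⟨((IsCMField.complexConj (F : Type)) • w), rfl⟩ : UnitaryGroup.PlacesOver (F : Type) (((IsCMField.complexConj (F : Type)) • w).under (𝓞 ↥(maximalRealSubfield (F : Type)))))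
                  (IsCMField.complexConj_ne_one (F : Type)) hJ hw' (UnitaryGroup.isUnit_placeForm Jstar hJu ((IsCMField.complexConj (F : Type)) • w)) (HeckeCharacter.uniformizer (F : Type) ((IsCMField.complexConj (F : Type)) • w)) 1 x)) +
                f' x = 0 := by
  classical
  obtain ⟨S₀, hS₀, hD9⟩ := hD9M
  have hinj : Function.Injective (fun w : HeightOneSpectrum (𝓞 (F : Type)) => (IsCMField.complexConj (F : Type)) • w) :=
    MulAction.injective _
  refine ⟨(fun w : HeightOneSpectrum (𝓞 (F : Type)) => (IsCMField.complexConj (F : Type)) • w) ⁻¹' S₀,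
    Set.Finite.preimage hinj.injOn hS₀, ?_⟩
  intro w hwS hw hw' hJi hK 𝔓 h𝔓 σ hσ f' hf' x hx
  rw [Set.mem_preimage] at hwS
  -- (K2c): a Frobenius `σ'` at some `𝔓' ∣ c • w` on `M⋆` with `ψ ∘ Φ_X σ = Φ_M σ' ∘ ψ`
  refine (hψF w hw 𝔓 h𝔓 σ hσ).elim fun σ' hσσ => hσσ.1.elim fun 𝔓' h𝔓σ => ?_
  have h𝔓' := h𝔓σ.1
  have hσ' := h𝔓σ.2
  have hcomm := hσσ.2
  -- `ψ̄ := 1 ⊗ ψ`: Galois and Hecke intertwining, injectivity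
  have hGal : ∀ z, (ψ.toLinearMap.baseChange (AlgebraicClosure ℚ_[ℓ]))
      (((sec42DataGS S h4 isoₛ).towerRep ℓ σ).baseChange (AlgebraicClosure ℚ_[ℓ]) z) =
      (C_M.towerRep ℓ σ').baseChange (AlgebraicClosure ℚ_[ℓ]) ((ψ.toLinearMap.baseChange (AlgebraicClosure ℚ_[ℓ])) z) :=
    fun z => baseChange_intertwine ψ.toLinearMap _ _ hcomm z
  have hHecke : ∀ (g : ↥(finAdelic ↥(maximalRealSubfield (F : Type)) (F : Type) (IsCMField.complexConj (F : Type)) 2 Jstar)) z,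
      (ψ.toLinearMap.baseChange (AlgebraicClosure ℚ_[ℓ]))
        (((etaleHeckeDatumGS S hU7ₛ hLQ h4 isoₛ ℓ).rhoEt g).baseChange (AlgebraicClosure ℚ_[ℓ]) z) =
        (X_M.rhoEt g).baseChange (AlgebraicClosure ℚ_[ℓ]) ((ψ.toLinearMap.baseChange (AlgebraicClosure ℚ_[ℓ])) z) :=
    fun g z => baseChange_intertwine ψ.toLinearMap _ _ (hψH g) z
  have hψinj : Function.Injective (ψ.toLinearMap.baseChange (AlgebraicClosure ℚ_[ℓ])) := fun a b hab =>
    (baseChange_symm_apply_baseChange ψ a).symm.trans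
      ((congrArg (ψ.symm.toLinearMap.baseChange (AlgebraicClosure ℚ_[ℓ])) hab).trans (baseChange_symm_apply_baseChange ψ b))
  -- `g := ψ̄ ∘ f′ ∈ Hom(ι′ ∘ ω, H¹(M⋆))` by (K2b)
  have hg : (ψ.toLinearMap.baseChange (AlgebraicClosure ℚ_[ℓ])).comp f' ∈ X_M.omegaHom ι' ω :=
    (Sec42Data.EtaleHeckeDatum.mem_omegaHom_iff _ _ _ _).2 fun g v =>
      (congrArg (ψ.toLinearMap.baseChange (AlgebraicClosure ℚ_[ℓ]))
          ((Sec42Data.EtaleHeckeDatum.mem_omegaHom_iff _ _ _ _).1 hf' g v)).trans (hHecke g (f' v))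
  -- [D.9 on M⋆] at `w′ := c • w`, `(σ′, 𝔓′)`, `g`, `x`
  have rel := hD9 ((IsCMField.complexConj (F : Type)) • w) hwS hw' hJi hK 𝔓' h𝔓' σ' hσ'
    ((ψ.toLinearMap.baseChange (AlgebraicClosure ℚ_[ℓ])).comp f') hg x hx
  simp only [LinearMap.comp_apply] at rel
  -- `N(c • w) = N(w)` — through a generalised coefficient (no `rw` across the operator telescopes)
  have hq : (Ideal.absNorm ((IsCMField.complexConj (F : Type)) • w).asIdeal : AlgebraicClosure ℚ_[ℓ]) = (Ideal.absNorm w.asIdeal : AlgebraicClosure ℚ_[ℓ]) := by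
    rw [HeightOneSpectrum.absNorm_algEquiv_smul]
  have relq : ∀ q : AlgebraicClosure ℚ_[ℓ], (Ideal.absNorm ((IsCMField.complexConj (F : Type)) • w).asIdeal : AlgebraicClosure ℚ_[ℓ]) = q →
      q • (C_M.towerRep ℓ σ').baseChange (AlgebraicClosure ℚ_[ℓ])
            ((C_M.towerRep ℓ σ').baseChange (AlgebraicClosure ℚ_[ℓ])
              ((ψ.toLinearMap.baseChange (AlgebraicClosure ℚ_[ℓ])) (f' (UnitaryGroup.heckeTAt ↥(maximalRealSubfield (F : Type)) (F : Type) (IsCMField.complexConj (F : Type)) 2 Jstar ω K.1.1 (⟨((IsCMField.complexConj (F : Type)) • w), rfl⟩ : UnitaryGroup.PlacesOver (F : Type) (((IsCMField.complexConj (F : Type)) • w).under (𝓞 ↥(maximalRealSubfield (F : Type)))))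
                  (IsCMField.complexConj_ne_one (F : Type)) hJ hw' (UnitaryGroup.isUnit_placeForm Jstar hJu ((IsCMField.complexConj (F : Type)) • w)) (HeckeCharacter.uniformizer (F : Type) ((IsCMField.complexConj (F : Type)) • w)) 2 x)))) -
          (C_M.towerRep ℓ σ').baseChange (AlgebraicClosure ℚ_[ℓ]) ((ψ.toLinearMap.baseChange (AlgebraicClosure ℚ_[ℓ])) (f' (UnitaryGroup.heckeTAt ↥(maximalRealSubfield (F : Type)) (F : Type) (IsCMField.complexConj (F : Type)) 2 Jstar ω K.1.1 (⟨((IsCMField.complexConj (F : Type)) • w), rfl⟩ : UnitaryGroup.PlacesOver (F : Type) (((IsCMField.complexConj (F : Type)) • w).under (𝓞 ↥(maximalRealSubfield (F : Type)))))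
                  (IsCMField.complexConj_ne_one (F : Type)) hJ hw' (UnitaryGroup.isUnit_placeForm Jstar hJu ((IsCMField.complexConj (F : Type)) • w)) (HeckeCharacter.uniformizer (F : Type) ((IsCMField.complexConj (F : Type)) • w)) 1 x))) +
        (ψ.toLinearMap.baseChange (AlgebraicClosure ℚ_[ℓ])) (f' x) = 0 := by
    rintro q rfl
    exact rel
  -- `ψ̄` applied to the `X⋆`-side expression is the `M⋆`-side expression (small terms: abstract `y`'s)
  have key : ∀ (q : AlgebraicClosure ℚ_[ℓ]) (y₂ y₁ y₀ : AlgebraicClosure ℚ_[ℓ] ⊗[ℚ_[ℓ]] (sec42DataGS S h4 isoₛ).etaleH1Tower ℓ),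
      (ψ.toLinearMap.baseChange (AlgebraicClosure ℚ_[ℓ])) (q • ((sec42DataGS S h4 isoₛ).towerRep ℓ σ).baseChange (AlgebraicClosure ℚ_[ℓ]) (((sec42DataGS S h4 isoₛ).towerRep ℓ σ).baseChange (AlgebraicClosure ℚ_[ℓ]) y₂) - ((sec42DataGS S h4 isoₛ).towerRep ℓ σ).baseChange (AlgebraicClosure ℚ_[ℓ]) y₁ + y₀) =
      q • (C_M.towerRep ℓ σ').baseChange (AlgebraicClosure ℚ_[ℓ]) ((C_M.towerRep ℓ σ').baseChange (AlgebraicClosure ℚ_[ℓ]) ((ψ.toLinearMap.baseChange (AlgebraicClosure ℚ_[ℓ])) y₂)) - (C_M.towerRep ℓ σ').baseChange (AlgebraicClosure ℚ_[ℓ]) ((ψ.toLinearMap.baseChange (AlgebraicClosure ℚ_[ℓ])) y₁) + (ψ.toLinearMap.baseChange (AlgebraicClosure ℚ_[ℓ])) y₀ := by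
    intro q y₂ y₁ y₀
    -- explicit congruence chain (no `rw` across the tensor-product/direct-limit instances)
    exact ((ψ.toLinearMap.baseChange (AlgebraicClosure ℚ_[ℓ])).map_add _ _).trans <|
      congrArg (· + (ψ.toLinearMap.baseChange (AlgebraicClosure ℚ_[ℓ])) y₀) <|
        ((ψ.toLinearMap.baseChange (AlgebraicClosure ℚ_[ℓ])).map_sub _ _).trans <|
          congrArg₂ (· - ·)
            (((ψ.toLinearMap.baseChange (AlgebraicClosure ℚ_[ℓ])).map_smul q _).trans
              (congrArg (q • ·) ((hGal _).trans
                (congrArg (fun t => (C_M.towerRep ℓ σ').baseChange (AlgebraicClosure ℚ_[ℓ]) t) (hGal y₂)))))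
            (hGal y₁)
  -- strip the injective `ψ̄`
  exact hψinj (((key _ _ _ _).trans (relq _ hq)).trans (map_zero _).symm)


/-- **`K2D9MShape`** — per label: an untwisted §4.2 datum `C_M` over the same `P5` with étale Hecke datum `X_M`, a K2 transport `ψ`
((K2a) linear equivalence of étale H¹ towers, (K2b) Hecke-compatible, (K2c) Frobenius at `𝔓 ∣ w` on `X⋆` ↦ a Frobenius at some `𝔓′ ∣ c • w`
on `M⋆` through `ψ`), and [Liu2021, Cor. D.9] ON `M⋆` VERBATIM (same place, standard anchor) for the registered carrier `ω⋆` at every level `K`. -/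
def K2D9MShape : Prop :=
  ∀ (F : CMField) [IsGalois ℚ F] (ι₁ : F →+* ℂ)
    (μ : Literature.NumberTheory.Automorphic.IdeleClassGroup (F : Type) →ₜ* Circle)
    (hμ : IdeleClassGroup.IsConjugateSymplectic (F : Type) μ)
    (_hw : IdeleClassGroup.HasWeight (F : Type) μ 1)
    (ℓ : ℕ) [Fact ℓ.Prime] (ι' : ℂ ≃+* AlgebraicClosure ℚ_[ℓ])
    (Jstar : Matrix (Fin 2) (Fin 2) (F : Type)) (t : (F : Type)) (ht : t ≠ 0) (_hτt : 0 < (ι₁ t).re) (_hτt' : (ι₁ t).im = 0)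
    (gstar : GL (Fin 2) (F : Type))
    (dJ : Fin 2 → (F : Type)) (hdJ : ∀ i, IsCMField.complexConj (F : Type) (dJ i) = dJ i) (hdJ0 : ∀ i, dJ i ≠ 0)
    (hg : formCongr ((IsCMField.complexConj (F : Type) : (F : Type) ≃ₐ[↥(maximalRealSubfield (F : Type))] (F : Type)) :
        (F : Type) →+* (F : Type)) gstar (t • Jstar) = Matrix.diagonal dJ)
    (_hsig : (∃ Tstar : GL (Fin 2) ℂ,
        formCongr (starRingEnd ℂ) Tstar ((Matrix.diagonal dJ).map ι₁) = Matrix.diagonal ![(1 : ℂ), -1]) ∧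
      ∀ τ' : (F : Type) →+* ℂ, InfinitePlace.mk τ' ≠ InfinitePlace.mk ι₁ → ((Matrix.diagonal dJ).map τ').PosDef)
    (K₀ : C5.OpenCompactSubgroup ↥(finAdelic ↥(maximalRealSubfield (F : Type)) (F : Type) (IsCMField.complexConj (F : Type)) 2 Jstar))
    (S : RecordSystemGS (F : Type) Jstar ι₁ K₀) (hU7ₛ : S.HeckeTranslateDefinedOver) (hLQ : S.IsLevelQuotient)
    (h4 : 4 ≤ Module.finrank ℚ (F : Type)) (isoₛ : ℕ → Prop)
    (r : Rep ↥(maximalRealSubfield (F : Type)) (imagUnitSq F))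
    (ε : Eps ↥(maximalRealSubfield (F : Type)) (imagUnitSq F))
    (_hadm : ∃ e : (F : Type), IsAdmissibleElement (F : Type) hμ.cmType.1 e ∧
      epsOf ↥(maximalRealSubfield (F : Type)) (imagUnitSq F) (F : Type) (2 * imagUnit (F : Type))⁻¹ (-e) = ε)
    (χ : Chi ↥(maximalRealSubfield (F : Type)) (F : Type) (IsCMField.complexConj (F : Type))),
    ∀ (hJ : (Jstar.map (IsCMField.complexConj (F : Type)))ᵀ = Jstar) (hJu : IsUnit Jstar),
    ∃ (C_M : Sec42Data (Literature.NumberTheory.Automorphic.Liu2021.AppendixC.honestP5GSM (F : Type) Jstar K₀ S.M) isoₛ) (X_M : C_M.EtaleHeckeDatum ℓ)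
      (ψ : (sec42DataGS S h4 isoₛ).etaleH1Tower ℓ ≃ₗ[ℚ_[ℓ]] C_M.etaleH1Tower ℓ),
      (∀ (g : ↥(finAdelic ↥(maximalRealSubfield (F : Type)) (F : Type) (IsCMField.complexConj (F : Type)) 2 Jstar))
        (y : (sec42DataGS S h4 isoₛ).etaleH1Tower ℓ), ψ ((etaleHeckeDatumGS S hU7ₛ hLQ h4 isoₛ ℓ).rhoEt g y) = X_M.rhoEt g (ψ y)) ∧
      (∀ w : HeightOneSpectrum (𝓞 (F : Type)), (IsCMField.complexConj (F : Type)) • w ≠ w →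
        ∀ 𝔓 ∈ w.primesAbove, ∀ σ : Field.absoluteGaloisGroup (F : Type), IsArithFrobAt (𝓞 (F : Type)) σ 𝔓 →
          ∃ σ' : Field.absoluteGaloisGroup (F : Type),
            (∃ 𝔓' ∈ ((IsCMField.complexConj (F : Type)) • w).primesAbove, IsArithFrobAt (𝓞 (F : Type)) σ' 𝔓') ∧
            ∀ y, ψ ((sec42DataGS S h4 isoₛ).towerRep ℓ σ y) = C_M.towerRep ℓ σ' (ψ y)) ∧
      ∀ K : C5.SmallLevel K₀,
        ∃ S₀ : Set (HeightOneSpectrum (𝓞 (F : Type))), S₀.Finite ∧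
      ∀ w : HeightOneSpectrum (𝓞 (F : Type)), w ∉ S₀ → ∀ hw : (IsCMField.complexConj (F : Type)) • w ≠ w,
        (UnitaryGroup.isUnit_placeForm Jstar hJu w).unit ∈ glInt 2 (w.adicCompletion (F : Type)) →
            UnitaryGroup.IsHyperspecialAt ↥(maximalRealSubfield (F : Type)) (F : Type) (IsCMField.complexConj (F : Type)) 2 Jstar K.1.1 (w.under (𝓞 ↥(maximalRealSubfield (F : Type)))) →
            ∀ 𝔓 ∈ w.primesAbove, ∀ σ : Field.absoluteGaloisGroup (F : Type), IsArithFrobAt (𝓞 (F : Type)) σ 𝔓 →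
            ∀ g ∈ X_M.omegaHom ι'
                ((rhoVAtLine ↥(maximalRealSubfield (F : Type)) (F : Type) (IsCMField.complexConj (F : Type)) 2
          (finProdFinEquiv : Fin 2 × Fin 1 ≃ Fin (2 * 1)) (Matrix.diagonal dJ)
          (complexConj_imagUnit F) (imagUnit_ne_zero F) (imagUnit_mul_self F) (realDiagonal_isSymm F dJ hdJ)
          (isUnit_det_realDiagonal F dJ hdJ hdJ0) (realDiagonal_map F dJ hdJ).symm
          (hsChiGS F finProdFinEquiv dJ hdJ hdJ0
            (toHeckeCharacter (F : Type) (galConj (IsCMField.complexConj (F : Type)) μ))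
            (isUnitary_toHeckeCharacter (F : Type) (galConj (IsCMField.complexConj (F : Type)) μ))
            ((isOscillatorChar_toHeckeCharacter_iff (galConj (IsCMField.complexConj (F : Type)) μ)).mpr hμ.galConj))
          (r.toFun ε) χ).comp
          (finAdelicCongr ↥(maximalRealSubfield (F : Type)) (F : Type) (IsCMField.complexConj (F : Type)) gstar ht hg).symm.toMonoidHom), ∀ x ∈ Representation.fixedPoints
                ((rhoVAtLine ↥(maximalRealSubfield (F : Type)) (F : Type) (IsCMField.complexConj (F : Type)) 2
          (finProdFinEquiv : Fin 2 × Fin 1 ≃ Fin (2 * 1)) (Matrix.diagonal dJ)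
          (complexConj_imagUnit F) (imagUnit_ne_zero F) (imagUnit_mul_self F) (realDiagonal_isSymm F dJ hdJ)
          (isUnit_det_realDiagonal F dJ hdJ hdJ0) (realDiagonal_map F dJ hdJ).symm
          (hsChiGS F finProdFinEquiv dJ hdJ hdJ0
            (toHeckeCharacter (F : Type) (galConj (IsCMField.complexConj (F : Type)) μ))
            (isUnitary_toHeckeCharacter (F : Type) (galConj (IsCMField.complexConj (F : Type)) μ))
            ((isOscillatorChar_toHeckeCharacter_iff (galConj (IsCMField.complexConj (F : Type)) μ)).mpr hμ.galConj))
          (r.toFun ε) χ).comp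
          (finAdelicCongr ↥(maximalRealSubfield (F : Type)) (F : Type) (IsCMField.complexConj (F : Type)) gstar ht hg).symm.toMonoidHom) K.1.1,
              (Ideal.absNorm w.asIdeal : AlgebraicClosure ℚ_[ℓ]) •
                  (C_M.towerRep ℓ σ).baseChange (AlgebraicClosure ℚ_[ℓ])
                    ((C_M.towerRep ℓ σ).baseChange (AlgebraicClosure ℚ_[ℓ])
                      (g (UnitaryGroup.heckeTAt ↥(maximalRealSubfield (F : Type)) (F : Type) (IsCMField.complexConj (F : Type)) 2 Jstar
                    ((rhoVAtLine ↥(maximalRealSubfield (F : Type)) (F : Type) (IsCMField.complexConj (F : Type)) 2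
          (finProdFinEquiv : Fin 2 × Fin 1 ≃ Fin (2 * 1)) (Matrix.diagonal dJ)
          (complexConj_imagUnit F) (imagUnit_ne_zero F) (imagUnit_mul_self F) (realDiagonal_isSymm F dJ hdJ)
          (isUnit_det_realDiagonal F dJ hdJ hdJ0) (realDiagonal_map F dJ hdJ).symm
          (hsChiGS F finProdFinEquiv dJ hdJ hdJ0
            (toHeckeCharacter (F : Type) (galConj (IsCMField.complexConj (F : Type)) μ))
            (isUnitary_toHeckeCharacter (F : Type) (galConj (IsCMField.complexConj (F : Type)) μ))
            ((isOscillatorChar_toHeckeCharacter_iff (galConj (IsCMField.complexConj (F : Type)) μ)).mpr hμ.galConj))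
          (r.toFun ε) χ).comp
          (finAdelicCongr ↥(maximalRealSubfield (F : Type)) (F : Type) (IsCMField.complexConj (F : Type)) gstar ht hg).symm.toMonoidHom)
                    K.1.1 (⟨w, rfl⟩ : UnitaryGroup.PlacesOver (F : Type) (w.under (𝓞 ↥(maximalRealSubfield (F : Type)))))
                  (IsCMField.complexConj_ne_one (F : Type)) hJ hw (UnitaryGroup.isUnit_placeForm Jstar hJu w) (HeckeCharacter.uniformizer (F : Type) w) 2 x))) -
                (C_M.towerRep ℓ σ).baseChange (AlgebraicClosure ℚ_[ℓ])
                  (g (UnitaryGroup.heckeTAt ↥(maximalRealSubfield (F : Type)) (F : Type) (IsCMField.complexConj (F : Type)) 2 Jstar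
                    ((rhoVAtLine ↥(maximalRealSubfield (F : Type)) (F : Type) (IsCMField.complexConj (F : Type)) 2
          (finProdFinEquiv : Fin 2 × Fin 1 ≃ Fin (2 * 1)) (Matrix.diagonal dJ)
          (complexConj_imagUnit F) (imagUnit_ne_zero F) (imagUnit_mul_self F) (realDiagonal_isSymm F dJ hdJ)
          (isUnit_det_realDiagonal F dJ hdJ hdJ0) (realDiagonal_map F dJ hdJ).symm
          (hsChiGS F finProdFinEquiv dJ hdJ hdJ0
            (toHeckeCharacter (F : Type) (galConj (IsCMField.complexConj (F : Type)) μ))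
            (isUnitary_toHeckeCharacter (F : Type) (galConj (IsCMField.complexConj (F : Type)) μ))
            ((isOscillatorChar_toHeckeCharacter_iff (galConj (IsCMField.complexConj (F : Type)) μ)).mpr hμ.galConj))
          (r.toFun ε) χ).comp
          (finAdelicCongr ↥(maximalRealSubfield (F : Type)) (F : Type) (IsCMField.complexConj (F : Type)) gstar ht hg).symm.toMonoidHom)
                    K.1.1 (⟨w, rfl⟩ : UnitaryGroup.PlacesOver (F : Type) (w.under (𝓞 ↥(maximalRealSubfield (F : Type)))))
                  (IsCMField.complexConj_ne_one (F : Type)) hJ hw (UnitaryGroup.isUnit_placeForm Jstar hJu w) (HeckeCharacter.uniformizer (F : Type) w) 1 x)) +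
                g x = 0

/-- **`S3ShapeM` ⇐ `K2D9MShape`** (one application of `s3M_clause_of_d9M_of_K2` per label and level; the ∃-package is consumed
by `Exists.elim` in term mode — no `casesOn` motive over the 30-binder goal, so the declaration runs on the default budget; A-p06 (g15) fix 3). -/
theorem s3ShapeM_of_K2D9M (h : K2D9MShape) : S3ShapeM := by
  intro F _ ι₁ μ hμ hw ℓ _ ι' Jstar t ht hτt hτt' gstar dJ hdJ hdJ0 hg hsig K₀ S hU7ₛ hLQ h4 isoₛ r ε hadm χ hJ hJu K
  exact (h F ι₁ μ hμ hw ℓ ι' Jstar t ht hτt hτt' gstar dJ hdJ hdJ0 hg hsig K₀ S hU7ₛ hLQ h4 isoₛ r ε hadm χ hJ hJu).elim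
    fun C_M h₁ => h₁.elim fun X_M h₂ => h₂.elim fun ψ h₃ =>
      s3M_clause_of_d9M_of_K2 F ℓ ι' Jstar K₀ S hU7ₛ hLQ h4 isoₛ hJ hJu _ C_M X_M ψ h₃.1 h₃.2.1 K (h₃.2.2 K)

/-- **THE HEAD WITH THE K2 LEG (WORLD M ∕ WORLD C)**: the REGISTERED `thmD6OneCurveCUF` from S1 (1), S1 (2), S2′, `K2D9MShape`
(= [D.9 on M⋆] FACT + `stub_K2`), and the ★-chain S4 — the next run's `Lines/d6_cm_curve.lean` composition of record, candidate. -/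
theorem thmD6OneCurveCUF_M_of_facts_K2 (h1a : S1Shape) (h1b : S1bShape) (h2 : S2primeShape) (hK : K2D9MShape) (h4 : S4ShapeA) :
    thmD6OneCurveCUF :=
  thmD6OneCurveCUF_M_of_facts_v9 h1a h1b h2 (s3ShapeM_of_K2D9M hK) h4

end Summit.HodgeConjecture.CorCM.Lines.A3Liu418

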